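import Summits.ResolutionOfSingularities.ResolutionOfSingularities.Theorems.FrobeniusClosingSteerLowTowerExists
import Summits.ResolutionOfSingularities.ResolutionOfSingularities.Theorems.FrobeniusClosingSteerCriticalThreadRun
import Summits.ResolutionOfSingularities.ResolutionOfSingularities.Theorems.FrobeniusClosingSteerLowTowerSigmaTopRun
import Summits.ResolutionOfSingularities.ResolutionOfSingularities.Theorems.FrobeniusClosingSteerWords07SteeredLeaves
import Summits.ResolutionOfSingularities.ResolutionOfSingularities.Theorems.FrobeniusClosingSteerWords09SteeredRegime
import Summits.ResolutionOfSingularities.ResolutionOfSingularities.Theorems.FrobeniusClosingSteerRunHygieneTwo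
import Summits.ResolutionOfSingularities.ResolutionOfSingularities.Theorems.FrobeniusClosingSteerRankFourExitTwo
import Summits.ResolutionOfSingularities.ResolutionOfSingularities.Theorems.FrobeniusClosingSteerMemberDualDerivations
import Summits.ResolutionOfSingularities.ResolutionOfSingularities.Theorems.FrobeniusClosingSteerLowShapeDuals
import Summits.ResolutionOfSingularities.ResolutionOfSingularities.Theorems.FrobeniusClosingSteerCriticalSurfaceDictionary
import HarnessLib

/-!
# Steer σ-residual, LOW half — D3a AS A TREE THEOREM: the LOW tower of a steered run exists (`LowTowerLeaf.exists_isLowTower_of_steeredRun`)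

OURS (campaign res-hironaka, rung L ★L-G4, slot W4.1, crux `Steer` stmt-ResolutionOfSingularities-16345; res-L0-w41-plan-1 RULINGS 120b/127;
res-L0-w41-stub-3 g6; replaces the role of no printed item; NOT a statement of the manuscript under review [claim: Hironaka2017,
status: under-review]; AI review is weaker than expert review). Theses-free, definition-free.

This is the CONTENT of the skeleton leaf `lowTowerExistsTwo_holds : LowTowerExistsTwo` (§σ2.24 D3a, certified on `Steer_r39.lean`
a669e685b579c44e) moved into the tree over the hoisted words (`CoreDatum` Words03, `IsSteeredRun` Words06, `IsHighOrderAt` Words09): along a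
2-steered run from the core datum which is LOW from some stage `i₀` on, res-D-pv-012's assembly `LowTower.exists_lowTower` (p528348) is fed BY
NAME with the run hygiene (res-D-pv-028 `RunHygiene.runHygieneTwo_of_steeredRun`), M (`Words.steeredMembersRegular_holds`), K-T1
(`TailCodim.ringKrullDim_member_eq`), the model at `i₀` (`SteeredExit.exists_model_of_tower`), the LOW shape with dual derivations at `i₀`
(res-L0-w41-stub-3 `RankFourExit.rankFour_exit_two` + res-D-pv-007 `MemberDualDerivations.hasDualDerivations_member` + res-type-072
`CriticalSurface.exists_lowShape_duals` / `isRsopPart_jacobianPair` / `isUnit_det_jacobianPair` / `criticalSurface`), `Λ = (R i₀)_𝔮₀`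
(`LowTower.exists_subring_locAtPrime`), the thread `hthread ∧ hinv` (res-type-096 `CriticalThread.criticalThread_run` over res-L0-w41-stub-3
`CriticalThread.thread_step`) and the σ_top semantics `hns ∧ hT9` (res-L0-w41-stub-3 `LowTowerInputs.sigmaTop_inputs_run`); every stage is
singular by the σ_top clause itself. The skeleton's antecedents `MembersDualDerivationsTwoN`, `RankFourExitTwo`, `LowSurfaceStepExitsTwo`,
`NormalAt`, `¬ HasProperCoarsening` are not needed. The conclusion is the body of `IsLowTowerTwo k L A Y h T x g pt` with
`IsPartialNormalisation` / `IsIntegralOver` / `IsSingPrime` unfolded VERBATIM as in `LowTower.exists_lowTower` (the skeleton leaf is then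
`intro …; exact` by unfolding). [cite: Cutkosky2014, §2.1] [cite: Lipman1978, (1.32)] [cite: Matsumura1987, Thm. 14.2] [folklore]
-/

noncomputable section

-- single-problem summit: the doubled namespace component `ResolutionOfSingularities` is forced
set_option linter.dupNamespace false

namespace Summit.ResolutionOfSingularities.ResolutionOfSingularities.Theorems.SwitchingDichotomy.LowTowerLeaf

open IsLocalRing Polynomial
open Literature.AlgebraicGeometry.Resolution
open Summit.ResolutionOfSingularities.ResolutionOfSingularities.Theorems.SwitchingDichotomy
open Summit.ResolutionOfSingularities.ResolutionOfSingularities.Theorems.SwitchingDichotomy.Words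

/-- **D3a · the LOW tower of a LOW 2-steered run exists** (run-level, hypothesis-free beyond the core datum, the run and the LOW regime;
see the module docstring for the named inputs). Conclusion = the body of the skeleton's `IsLowTowerTwo k L A Y h T x g pt` with `pt` the set
of point stages of the sub-run and the skeleton-level predicates unfolded as in `LowTower.exists_lowTower`. OURS.
[cite: Cutkosky2014, §2.1] [cite: Lipman1978, (1.32)] [cite: Matsumura1987, Thm. 14.2] [folklore] -/
theorem exists_isLowTower_of_steeredRun (p : ℕ) (hp : p = 2)
    (k K : Type) [Field k] [CharP k p] [PerfectField k] [Field K] [Algebra k K]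
    (O : ValuationSubring K) (A₀ : Subalgebra k K) (h₀ : A₀.toSubring ≤ O.toSubring) (t : K)
    (core : CoreDatum p 4 k K O A₀ h₀ t)
    (R : ℕ → Subring K) (P : (i : ℕ) → Ideal (R i)) (s : ℕ → K)
    (hR0 : R 0 = locAtCentre A₀.toSubring O) (hrun : IsSteeredRun O R P t p s)
    (hlow : ∃ i₀ : ℕ, ∀ i, i₀ ≤ i → ¬ IsHighOrderAt R s p i) :
    ∃ (L : Type) (_ : Field L) (_ : Algebra k L) (A Y : ℕ → Subalgebra k L) (h T x g : ℕ → L) (pt : Set ℕ),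
      ∃ (_ : CharP L 2) (hAl : ∀ n, IsLocalRing (A n).toSubring),
        -- (T0) frame of the field
        Algebra.trdeg k L = 2 ∧
        -- (T1) surface germs
        (∀ n, IsRegularLocalRing (A n).toSubring ∧ ringKrullDim (A n).toSubring = (2 : ℕ) ∧
          Algebra.EssFiniteType k (A n) ∧
          ∀ a : (A n).toSubring, ∃ b : (A n).toSubring, a - b ^ 2 ∈ @maximalIdeal _ _ (hAl n)) ∧
        -- (T2) members, their frame and their presentation
        (∀ n, h n ∈ A n ∧ T n ^ 2 = h n ∧
          (Y n).toSubring = Subring.closure (insert (T n) ((A n : Set L))) ∧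
          IsLocalRing (Y n) ∧ Algebra.EssFiniteType k (Y n) ∧ IsFractionRing (Y n) L) ∧
        -- (T3) hygiene
        (∀ n, ∀ u v : L, u ∈ A n → v ∈ A n → v ≠ 0 → (u / v) ^ 2 ≠ h n) ∧
        -- (T4) order descent
        (∀ n (hh : h n ∈ A n), ∃ γ : (A n).toSubring,
          (⟨h n, hh⟩ : (A n).toSubring) - γ ^ 2 ∈ (@maximalIdeal _ _ (hAl n)) ^ 2) ∧
        -- (T5) step data and laws
        (∀ n, g n ∈ A n ∧ x n ≠ 0 ∧ (∃ hx : x n ∈ A n, (⟨x n, hx⟩ : (A n).toSubring) ∈ @maximalIdeal _ _ (hAl n)) ∧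
          h (n + 1) * x n ^ 2 = h n - g n ^ 2 ∧ T (n + 1) * x n = T n - g n) ∧
        -- (T6) point stages
        (∀ n ∈ pt,
          @Literature.AlgebraicGeometry.Resolution.blowupRing _ _ (A n).toSubring (hAl n) (x n) ≤ (A (n + 1)).toSubring ∧
          (∀ z ∈ A (n + 1), ∃ a ∈ @Literature.AlgebraicGeometry.Resolution.blowupRing _ _ (A n).toSubring (hAl n) (x n),
            ∃ b ∈ @Literature.AlgebraicGeometry.Resolution.blowupRing _ _ (A n).toSubring (hAl n) (x n), b⁻¹ ∈ A (n + 1) ∧ z = a / b) ∧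
          SubringDominates (A n).toSubring (A (n + 1)).toSubring ∧
          IsQuadraticTransform (Y n).toSubring (Y (n + 1)).toSubring) ∧
        -- (T7) curve stages
        (∀ n ∉ pt, A (n + 1) = A n ∧ ((Y n).toSubring ≤ (Y (n + 1)).toSubring ∧ (Y n).toSubring ≠ (Y (n + 1)).toSubring ∧
            IsLocalRing (Y (n + 1)).toSubring ∧
            ∀ z ∈ (Y (n + 1)).toSubring, ∃ q : Polynomial L, q.Monic ∧ (∀ i, q.coeff i ∈ (Y n).toSubring) ∧ q.eval z = 0) ∧
          ¬ IsQuadraticTransform (Y n).toSubring (Y (n + 1)).toSubring) ∧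
        -- (T9) σ_top read on the surface
        (∀ n ∈ pt, ∀ (Q : Ideal (A n).toSubring) [Q.IsPrime], Q ≠ ⊥ → Q ≠ @maximalIdeal _ _ (hAl n) →
          IsRegularLocalRing ((A n).toSubring ⧸ Q) →
          ∀ hh : h n ∈ A n, ¬ ¬ IsRegularLocalRing (AdjoinRoot ((Polynomial.X : Polynomial (Localization.AtPrime Q)) ^ 2 -
            Polynomial.C (algebraMap (A n).toSubring (Localization.AtPrime Q) ⟨h n, hh⟩))))
 := by
  subst hp
  classical
  haveI : Fact (Nat.Prime 2) := ⟨Nat.prime_two⟩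
  haveI : CharP K 2 := charP_of_injective_algebraMap (algebraMap k K).injective 2
  obtain ⟨i₀, hi₀⟩ := hlow
  -- M: members regular
  have hreg : ∀ i, IsRegularLocalRing (R i) := fun i =>
    steeredMembersRegular_holds 2 Nat.prime_two 4 le_rfl k K O A₀ h₀ t core R P s i hR0
      ⟨hrun.1, fun j _ => by obtain ⟨_, hs, -⟩ := hrun.2 j; exact hs, fun j _ => hrun.2 j⟩
  -- run hygiene, dimension, blow-ups
  obtain ⟨hfg, htp, hfr, hreg0, -, hzd, hdim2, -, -, -, -, hc, htr, -⟩ := core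
  have hbl : ∀ i, IsLocalBlowupAlong O (R i) (P i) (R (i + 1)) := fun i => by
    obtain ⟨_, _, -, hbl, -⟩ := hrun.2 i
    exact hbl
  have hsp : ∀ i, s i ^ 2 ∈ R i := fun i => by
    obtain ⟨_, hs, -⟩ := hrun.2 i
    exact hs
  obtain ⟨-, hR, hdim4, hperf, -, -⟩ :=
    RunHygiene.runHygieneTwo_of_steeredRun O A₀ h₀ t hfg htp hfr hreg0 hzd hdim2 hc htr R P s hR0 hbl
      (fun i => by obtain ⟨_, _, -, -, hst⟩ := hrun.2 i; exact hst) hrun.1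
  have hdim : ∀ i, ringKrullDim (R i) = (4 : ℕ) := fun i =>
    TailCodim.ringKrullDim_member_eq k K O A₀ h₀ t two_pos hfg htp hfr hzd htr R i hR0 fun j _ => (hbl j).isLocalBlowup
  have hRO : ∀ i, SubringDominates (R i) O.toSubring := fun i => by
    obtain ⟨B, hB, e⟩ := hR i
    rw [e]
    exact subringDominates_locAtCentre hB
  -- the LOW shape with dual derivations at the first all-LOW stage `i₀` (B7 + duals + 072's normalisation)
  obtain ⟨hloc₀, hs₀, g₀, z₀, w₀, hz₀, hw₀, hf₀⟩ :=
    RankFourExit.rankFour_exit_two (fun S _ f Q => IsPermissibleCentre S 2 f Q) (fun _ _ _ _ h => ⟨h.1, h.2.1.fst, h.2.2.2⟩)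
      O R P s hrun.2 i₀ hR (hreg i₀) (hreg (i₀ + 1)) (hdim4 i₀) (hdim4 (i₀ + 1)) hperf
  obtain ⟨_, y, D, hy, hD⟩ :=
    MemberDualDerivations.hasDualDerivations_member 2 O A₀ h₀ t hfg htp hfr hzd (by exact_mod_cast htr) R hR0 i₀
      (fun i _ => (hbl i).isLocalBlowup) (hreg i₀)
  haveI := hreg i₀
  have hlow' : ∀ g' : R i₀, (⟨s i₀ ^ 2, hs₀⟩ : R i₀) - g' ^ 2 ∉ maximalIdeal (R i₀) ^ 3 :=
    fun g' h => hi₀ i₀ le_rfl ⟨hloc₀, hs₀, g', h⟩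
  obtain ⟨l₃, l₄, c, D₁, D₂, hfc, hcm, hspan, h11, h12, h21, h22⟩ :=
    CriticalSurface.exists_lowShape_duals (hperf i₀ hloc₀) y D hy hD _ g₀ z₀ w₀ hz₀ hw₀ hf₀ hlow'
  have hrsop₀ : IsRsopPart ![D₁ ⟨s i₀ ^ 2, hs₀⟩, D₂ ⟨s i₀ ^ 2, hs₀⟩] :=
    CriticalSurface.isRsopPart_jacobianPair (hdim i₀) _ g₀ z₀ w₀ l₃ l₄ c hfc hcm hspan D₁ D₂ h11 h12 h21 h22
  have hHess₀ : IsUnit (D₁ (D₁ ⟨s i₀ ^ 2, hs₀⟩) * D₂ (D₂ ⟨s i₀ ^ 2, hs₀⟩) -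
      D₁ (D₂ ⟨s i₀ ^ 2, hs₀⟩) * D₂ (D₁ ⟨s i₀ ^ 2, hs₀⟩)) :=
    CriticalSurface.isUnit_det_jacobianPair _ g₀ z₀ w₀ c hfc hcm D₁ D₂ h11 h12 h21 h22
  -- the critical prime `𝔮₀` at `i₀` and `Λ = (R i₀)_𝔮₀`
  haveI hq₀ : (Ideal.span {D₁ ⟨s i₀ ^ 2, hs₀⟩, D₂ ⟨s i₀ ^ 2, hs₀⟩}).IsPrime :=
    (CriticalSurface.criticalSurface (hdim i₀) _ g₀ z₀ w₀ l₃ l₄ c hfc hcm hspan D₁ D₂ h11 h12 h21 h22).1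
  obtain ⟨Λ, h1, h2, h4⟩ :=
    LowTower.exists_subring_locAtPrime (R i₀) (Ideal.span {D₁ ⟨s i₀ ^ 2, hs₀⟩, D₂ ⟨s i₀ ^ 2, hs₀⟩})
  haveI hΛl : IsLocalRing Λ := LowTower.isLocalRing_of_locAtPrime (R i₀) Λ _ h1 h2 h4
  -- the sub-run from `i₀` in the words of `CriticalThread.criticalThread_run`
  have hreg' : ∀ n, IsRegularLocalRing (R (i₀ + n)) := fun n => hreg (i₀ + n)
  have hRO' : ∀ n, SubringDominates (R (i₀ + n)) O.toSubring := fun n => hRO (i₀ + n)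
  have hdimn : ∀ n, ringKrullDim (R (i₀ + n)) = (4 : ℕ) := fun n => hdim (i₀ + n)
  have hperf' : ∀ n (a : R (i₀ + n)), ∃ b : R (i₀ + n), a - b ^ 2 ∈ maximalIdeal (R (i₀ + n)) :=
    fun n a => hperf (i₀ + n) inferInstance a
  have hs2 : ∀ n, s (i₀ + n) ^ 2 ∈ R (i₀ + n) := fun n => hsp (i₀ + n)
  have hrun' : ∀ n,
      (P (i₀ + n) = maximalIdeal (R (i₀ + n)) ∨
        (P (i₀ + n) ≠ maximalIdeal (R (i₀ + n)) ∧ (P (i₀ + n)).IsPrime ∧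
          IsRegularLocalRing (R (i₀ + n) ⧸ P (i₀ + n)) ∧
          ∃ g : R (i₀ + n), (⟨s (i₀ + n) ^ 2, hs2 n⟩ : R (i₀ + n)) - g ^ 2 ∈ P (i₀ + n) ^ 2)) ∧
      IsLocalBlowupAlong O (R (i₀ + n)) (P (i₀ + n)) (R (i₀ + n + 1)) ∧
      ∃ x G : K, (∃ hx : x ∈ R (i₀ + n), (⟨x, hx⟩ : R (i₀ + n)) ∈ P (i₀ + n)) ∧ x ≠ 0 ∧
        (∀ y : R (i₀ + n), y ∈ P (i₀ + n) → O.valuation (y : K) ≤ O.valuation x) ∧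
        G ∈ R (i₀ + n) ∧ s (i₀ + n) = x * s (i₀ + n + 1) + G := by
    intro n
    obtain ⟨hloc, hs, hσ, hbln, x, G, hxe, hG, hst⟩ := hrun.2 (i₀ + n)
    refine ⟨?_, hbln, x, G, hxe.1, hxe.2.1, hxe.2.2, hG, hst⟩
    rcases hσ with hperm | ⟨hPm, -, -⟩
    · obtain ⟨hne, ⟨hpr, -⟩, hregq, g, hg⟩ := hperm
      exact Or.inr ⟨hne, hpr, hregq, g, hg⟩
    · exact Or.inl hPm
  have hsing : ∀ n, ∃ γ : R (i₀ + n),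
      (⟨s (i₀ + n) ^ 2, hs2 n⟩ : R (i₀ + n)) - γ ^ 2 ∈ maximalIdeal (R (i₀ + n)) ^ 2 := by
    intro n
    obtain ⟨hloc, hs, hσ, -, -⟩ := hrun.2 (i₀ + n)
    rcases hσ with hperm | ⟨-, -, g, hg⟩
    · obtain ⟨-, ⟨hpr, -⟩, -, g, hg⟩ := hperm
      exact ⟨g, Ideal.pow_right_mono (IsLocalRing.le_maximalIdeal hpr.ne_top) 2 hg⟩
    · exact ⟨g, hg⟩
  have hσ' : ∀ n (hl : IsLocalRing (R (i₀ + n))),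
      SigmaTopLegality.IsPermissibleCentre (R (i₀ + n)) 2 ⟨s (i₀ + n) ^ 2, hs2 n⟩ (P (i₀ + n)) ∨
        (P (i₀ + n) = maximalIdeal (R (i₀ + n)) ∧
          (∀ Q : Ideal (R (i₀ + n)),
            ¬ SigmaTopLegality.IsPermissibleCentre (R (i₀ + n)) 2 ⟨s (i₀ + n) ^ 2, hs2 n⟩ Q) ∧
          ∃ g : R (i₀ + n), (⟨s (i₀ + n) ^ 2, hs2 n⟩ : R (i₀ + n)) - g ^ 2 ∈ maximalIdeal (R (i₀ + n)) ^ 2) := by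
    intro n hl
    obtain ⟨hloc, hs, hσ, -, -⟩ := hrun.2 (i₀ + n)
    exact hσ
  -- (A2) the thread: `hthread ∧ hinv` (res-type-096 over `thread_step`)
  obtain ⟨hthread, hinv⟩ :=
    CriticalThread.criticalThread_run O R P s i₀ hreg' hRO' hdimn hperf' hs2 hrun' hsing Λ h1 D₁ D₂ h2 h4 hrsop₀ hHess₀
      {n | P (i₀ + n) = maximalIdeal (R (i₀ + n))} (fun n => Iff.rfl)
  -- σ_top semantics: `hns ∧ hT9`
  obtain ⟨hns, hT9⟩ :=
    LowTowerInputs.sigmaTop_inputs_run O R P s i₀ hreg' hRO' hdimn hs2 hσ' (fun n => hbl (i₀ + n))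
      (fun n => (hrun' n).2.2) hsing Λ hinv
  -- the model at `i₀`
  obtain ⟨B, hBO, -, hBfg, hRB⟩ :=
    SteeredExit.exists_model_of_tower O A₀ h₀ hfg hR0 (N := i₀) fun i _ => (hbl i).isLocalBlowup
  -- D3a assembly (res-D-pv-012)
  obtain ⟨L, _iF, _iA, A, Y, h, T, x, g, htower⟩ :=
    LowTower.exists_lowTower (k := k) O R s i₀ hzd B hBfg hBO hRB.symm (fun n => (hbl (i₀ + n)).isLocalBlowup) hdimn
      (fun n hl a => hperf (i₀ + n) hl a) (Ideal.span {D₁ ⟨s i₀ ^ 2, hs₀⟩, D₂ ⟨s i₀ ^ 2, hs₀⟩}) Λ h1 h2 h4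
      {n | P (i₀ + n) = maximalIdeal (R (i₀ + n))} hthread hinv (fun n _ _ => hsing n) hns
      (fun n hn => hT9 n ⟨inferInstance, hn⟩)
  exact ⟨L, _iF, _iA, A, Y, h, T, x, g, {n | P (i₀ + n) = maximalIdeal (R (i₀ + n))}, htower⟩

end Summit.ResolutionOfSingularities.ResolutionOfSingularities.Theorems.SwitchingDichotomy.LowTowerLeaf

end
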